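import Literature.IUT.LogVolume.TensorPacketHullContainers
import Literature.IUT.LogVolume.TensorPacketMeasure
import Literature.IUT.LogVolume.TensorPacketLogTransport
import HarnessLib

/-!
# The log-volume of the hull of a union of possible images on the REAL tensor packet ([IUTchIV] Thm. 1.10,
# proof, Steps (v)–(vi): the per-summand UPPER BOUNDS, volume half)

Mochizuki, *Inter-universal Teichmüller theory IV* (RIMS ms Apr. 2020 = PRIMS **57** (2021)), proof of
Thm. 1.10, Step (v), p. 28: "an upper bound on the component of the log-volume of the holomorphic hull …
may be obtained by computing an upper bound for the log-volume of the right-hand side of the inclusion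
“`p^{⌊λ−d_I−a_I⌋}·log_p(R_I^×) ⊆ p^{⌊λ−d_I−a_I⌋−b_I}·(R_I)^∼`” of Proposition 1.4, (iii). Such an upper bound
“`(−λ + d_I + 1)·log(p) + Σ_{i∈I*} {3 + log(e_i)}`” is given in the second displayed inequality of
Proposition 1.4, (iii)"; Step (vi), p. 29: "Such an upper bound “`0`” is given in the final equality of
Proposition 1.4, (iv)".

THIS FILE composes, on the cell's real tensor packet `V = PacketAlgebra p k` with abc-iut-c312-3's
normalised log-measure `packetLogμ` / admissibility `PacketAdm` (`TensorPacketMeasure.lean`, Dupuy–Hilado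
Def. 3.6.1 along the chosen decomposition `dEquiv`):
* the CONTAINERS of `TensorPacketHullContainers.lean` (abc-iut-S2: under `Prop12ii` the hull of the union of
  possible images `autImages (ι_{i†}(g)·(R_I)^∼)` lies in the translate `(p^n·⊗h_i)·(R_I)^∼`,
  `n = ⌊λ−d_I−a_I⌋`; under `Prop12iv` the hull of `autImages (R_I)^∼` is `(R_I)^∼`), with
* abc-iut-S8's PROVED second inequality of Prop. 1.4 (iii) (`LogVolumeEstimates.Prop14iii₂_holds`:
  `μ^log((p^n·⊗h_i)·(R_I)^∼) ≤ (−λ + d_I + 1)·log(p) + Σ_{i∈I*}{3 + log(e_i)}`) and the normalisation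
  `μ^log((R_I)^∼) = 0`,
to obtain, for the real packet: `packetAdm_packetHull` (the hull of a region trapped between an admissible
set and a nondegenerate translate is ADMISSIBLE — the `hull_adm` datum of a `DHData`),
**`packetLogμ_packetHull_autImages_le`** (Step (v): the log-volume of the hull of the union of possible
images of `ι_{i†}(g)·(R_I)^∼`, `ord(g) = λ`, is `≤ (−λ + d_I + 1)·log(p) + Σ_{i∈I*}{3 + log(e_i)}`, modulo the
HYPOTHESIS `Prop12ii` = [IUTchIV] Prop. 1.2 (ii), abc-iut-S6's to prove) and
**`packetLogμ_packetHull_autImages_normalizedPacket`** (Step (vi): `= 0`, modulo `Prop12iv`).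
These are the per-summand bounds that `HullVolumeAssembly` / `LDHEstimateAssembly` average into
`EstimateDH` — for the regions Mochizuki's text names ("`φ(p^λ·(R_I)^∼)`", arbitrary `φ`). Whether the
components of `U_Θ` of a given Dupuy–Hilado datum ARE such unions (the (Ind3) datum; the (Ind1) slot
permutations for non-constant collections) is NOT addressed here (`MultiradialRegion` instance, abc-iut-c312-3 /
c312-d1). Nothing here takes a side on [IUTchIII] Cor. 3.12.
[cite: Mochizuki2012, IUTchIV Thm 1.10 proof Step (v) p.28, Step (vi) p.29] [cite: DupuyHilado2025, Def. 3.6.1, §4.12]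
-/

noncomputable section

open Set MeasureTheory
open scoped Pointwise TensorProduct

namespace Literature.IUT.LogVolume

variable (p : ℕ) [Fact p.Prime]
variable {I : Type} [Fintype I] [DecidableEq I]
variable (k : I → Type) [∀ i, NontriviallyNormedField (k i)] [∀ i, NormedAlgebra ℚ_[p] (k i)]
  [∀ i, IsUltrametricDist (k i)] [∀ i, ProperSpace (k i)]

/-! ## Admissibility of hulls trapped between an admissible region and a translate -/

omit [DecidableEq I] [∀ i, IsUltrametricDist (k i)] in
/-- The packet measure (read through `ψ`) is monotone under inclusion (outer measure; no measurability).
[cite: DupuyHilado2025, Def. 3.6.1] -/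
theorem packetVol_mono {A B : Set (PacketAlgebra p k)} (h : A ⊆ B) : packetVol p k A ≤ packetVol p k B :=
  measure_mono (Set.image_mono h)

omit [DecidableEq I] [∀ i, IsUltrametricDist (k i)] in
/-- A region between two admissible regions is admissible. [cite: DupuyHilado2025, Def. 3.5.1] -/
theorem packetAdm_of_subset_of_subset {A U C : Set (PacketAlgebra p k)} (hA : PacketAdm p k A)
    (hC : PacketAdm p k C) (hAU : A ⊆ U) (hUC : U ⊆ C) : PacketAdm p k U :=
  ⟨hA.1.trans_le (packetVol_mono p k hAU), (packetVol_mono p k hUC).trans_lt hC.2⟩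

variable [Nonempty I]

/-- **Hulls are admissible** when trapped: if `A ⊆ U ⊆ g·(R_I)^∼` with `A` admissible and `g` nondegenerate
(all components `ψ(g)_j ≠ 0`), then `hull(U)` is admissible — it contains `A` and lies in the hull-closed
translate `g·(R_I)^∼` (the `hull_adm` datum "`−|log(Θ)| ∈ ℝ`" of a Dupuy–Hilado datum, for such regions).
[cite: DupuyHilado2025, §4.12 p. 16] -/
theorem packetAdm_packetHull {A U : Set (PacketAlgebra p k)} {g : PacketAlgebra p k}
    (hg : ∀ j, dEquiv p k g j ≠ 0) (hA : PacketAdm p k A) (hAU : A ⊆ U)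
    (hU : U ⊆ g • (normalizedPacket p k : Set (PacketAlgebra p k))) : PacketAdm p k (packetHull p k U) :=
  packetAdm_of_subset_of_subset p k hA (packetAdm_smul_normalizedPacket p k g hg)
    (hAU.trans (subset_packetHull p k U)) (packetHull_subset_smul_normalizedPacket p k hU)

/-- … and then `log μ̄(hull(U)) ≤ log μ̄(g·(R_I)^∼)`. [cite: DupuyHilado2025, §4.12 p. 16] -/
theorem packetLogμ_packetHull_le_smul_normalizedPacket {A U : Set (PacketAlgebra p k)}
    {g : PacketAlgebra p k} (hg : ∀ j, dEquiv p k g j ≠ 0) (hA : PacketAdm p k A) (hAU : A ⊆ U)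
    (hU : U ⊆ g • (normalizedPacket p k : Set (PacketAlgebra p k))) :
    packetLogμ p k (packetHull p k U) ≤
      packetLogμ p k (g • (normalizedPacket p k : Set (PacketAlgebra p k))) :=
  packetLogμ_mono p k (packetAdm_packetHull p k hg hA hAU hU) (packetAdm_smul_normalizedPacket p k g hg)
    (packetHull_subset_smul_normalizedPacket p k hU)

/-! ## The translate `(p^n·⊗h_i)·(R_I)^∼` is nondegenerate -/

omit [∀ i, IsUltrametricDist (k i)] [Nonempty I] in
/-- The components of `ψ(⊗h_i)` are products of the images of the `h_i` under the isometric component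
embeddings, hence nonzero when all `h_i ≠ 0`. [cite: Mochizuki2012, IUTchIV Prop. 1.4 (i) p. 13] -/
theorem dEquiv_purePacket_ne_zero {h : Π i, k i} (hh : ∀ i, h i ≠ 0) (j : DIdx p k) :
    dEquiv p k (purePacket p k h) j ≠ 0 := by
  rw [psi_purePacket_apply]
  refine Finset.prod_ne_zero_iff.mpr fun i _ => ?_
  rw [← norm_pos_iff, norm_factorEmb]
  exact norm_pos_iff.mpr (hh i)

omit [∀ i, IsUltrametricDist (k i)] [Nonempty I] in
/-- The components of `ψ(p^n·⊗h_i)` are nonzero when all `h_i ≠ 0`. [cite: Mochizuki2012, IUTchIV Prop. 1.4 (i) p. 13] -/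
theorem dEquiv_ppow_mul_purePacket_ne_zero (n : ℤ) {h : Π i, k i} (hh : ∀ i, h i ≠ 0) (j : DIdx p k) :
    dEquiv p k (ppow p k n * purePacket p k h) j ≠ 0 := by
  rw [map_mul, Pi.mul_apply]
  refine mul_ne_zero ?_ (dEquiv_purePacket_ne_zero p k hh j)
  rw [← norm_pos_iff, norm_psi_ppow_apply]
  have hp : (0 : ℝ) < p := by exact_mod_cast (Fact.out : p.Prime).pos
  positivity

/-! ## Step (v): the log-volume of the hull of the union of possible images of `p^λ·(R_I)^∼` -/

omit [Fintype I] [DecidableEq I] [∀ i, NormedAlgebra ℚ_[p] (k i)] [∀ i, IsUltrametricDist (k i)]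
  [∀ i, ProperSpace (k i)] [Nonempty I] in
/-- An element of valuation `λ` is nonzero (its norm is `p^{−λ} > 0`). [folklore] -/
private theorem ne_zero_of_norm_eq_rpow {i : I} {g : k i} {t : ℝ} (hg : ‖g‖ = (p : ℝ) ^ t) : g ≠ 0 := by
  rw [← norm_pos_iff, hg]
  have hp : (0 : ℝ) < p := by exact_mod_cast (Fact.out : p.Prime).pos
  positivity

/-- Under `Prop12ii`: the hull of the union of possible images of `ι_{i†}(g)·(R_I)^∼` (`ord(g) = λ = m/e_{i†}`)
is ADMISSIBLE (its log-measure is a real number). [cite: Mochizuki2012, IUTchIV Thm 1.10 proof Step (v) p.28] -/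
theorem packetAdm_packetHull_autImages (h12 : Prop12ii p k) (hI : 2 ≤ Fintype.card I) (i : I) (m : ℤ)
    (g : k i) (hg : ‖g‖ = (p : ℝ) ^ (-((m : ℝ) / absRamificationIdx p (k i))))
    (h : Π i, k i) (hh : RealizesNegB p k h) :
    PacketAdm p k (packetHull p k
      (autImages p k (iota p k i g • (normalizedPacket p k : Set (PacketAlgebra p k))))) :=
  packetAdm_packetHull p k (dEquiv_ppow_mul_purePacket_ne_zero p k _ (ne_zero_of_realizesNegB p k hh))
    (packetAdm_iota_smul p k i (ne_zero_of_norm_eq_rpow p k hg) (packetAdm_normalizedPacket p k))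
    (subset_autImages p k _) (autImages_smul_normalizedPacket_subset_translate p k h12 hI i m g hg h hh)

/-- **Step (v) on the real packet — the per-summand upper bound.** Under [IUTchIV] Prop. 1.2 (ii)
(`Prop12ii`, hypothesis), for `|I| ≥ 2`, `I* ⊆ I` with `e_i ≤ p − 2` off `I*`, `i† ∈ I`, `g ∈ k_{i†}` with
`ord(g) = λ = m/e_{i†}`:
`log μ̄( hull( ⋃_φ φ(ι_{i†}(g)·(R_I)^∼) ) ) ≤ (−λ + d_I + 1)·log(p) + Σ_{i∈I*}{3 + log(e_i)}`
— the hull lies in `(p^{⌊λ−d_I−a_I⌋}·⊗h_i)·(R_I)^∼` (`TensorPacketHullContainers`) whose log-volume obeys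
the second inequality of Prop. 1.4 (iii) (abc-iut-S8's `Prop14iii₂_holds`, PROVED).
[cite: Mochizuki2012, IUTchIV Thm 1.10 proof Step (v) p.28] -/
theorem packetLogμ_packetHull_autImages_le (h12 : Prop12ii p k) (hI : 2 ≤ Fintype.card I)
    (Istar : Finset I) (htame : ∀ i, i ∉ Istar → absRamificationIdx p (k i) ≤ p - 2)
    (i : I) (m : ℤ) (g : k i) (hg : ‖g‖ = (p : ℝ) ^ (-((m : ℝ) / absRamificationIdx p (k i))))
    (h : Π i, k i) (hh : RealizesNegB p k h) :
    packetLogμ p k (packetHull p k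
        (autImages p k (iota p k i g • (normalizedPacket p k : Set (PacketAlgebra p k))))) ≤
      (-((m : ℝ) / absRamificationIdx p (k i)) + dSum p k + 1) * Real.log p
        + ∑ i' ∈ Istar, (3 + Real.log (absRamificationIdx p (k i'))) := by
  refine (packetLogμ_packetHull_le_smul_normalizedPacket p k
    (dEquiv_ppow_mul_purePacket_ne_zero p k _ (ne_zero_of_realizesNegB p k hh))
    (packetAdm_iota_smul p k i (ne_zero_of_norm_eq_rpow p k hg) (packetAdm_normalizedPacket p k))
    (subset_autImages p k _)
    (autImages_smul_normalizedPacket_subset_translate p k h12 hI i m g hg h hh)).trans ?_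
  exact Prop14iii₂_holds p k (DFac p k) (dEquiv p k) hI Istar htame i m h hh

/-- The same bound for the hull of ANY region `U` consisting of possible images of points of `ι_{i†}(g)·(R_I)^∼`
and containing that region (e.g. `U` = the union over a sub-family of the `φ`).
[cite: Mochizuki2012, IUTchIV Thm 1.10 proof Step (v) p.28] -/
theorem packetLogμ_packetHull_le_of_subset_autImages (h12 : Prop12ii p k) (hI : 2 ≤ Fintype.card I)
    (Istar : Finset I) (htame : ∀ i, i ∉ Istar → absRamificationIdx p (k i) ≤ p - 2)
    (i : I) (m : ℤ) (g : k i) (hg : ‖g‖ = (p : ℝ) ^ (-((m : ℝ) / absRamificationIdx p (k i))))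
    (h : Π i, k i) (hh : RealizesNegB p k h) {U : Set (PacketAlgebra p k)}
    (hgU : iota p k i g • (normalizedPacket p k : Set (PacketAlgebra p k)) ⊆ U)
    (hU : U ⊆ autImages p k (iota p k i g • (normalizedPacket p k : Set (PacketAlgebra p k)))) :
    PacketAdm p k (packetHull p k U) ∧
      packetLogμ p k (packetHull p k U) ≤
        (-((m : ℝ) / absRamificationIdx p (k i)) + dSum p k + 1) * Real.log p
          + ∑ i' ∈ Istar, (3 + Real.log (absRamificationIdx p (k i'))) := by
  have hg0 := ne_zero_of_norm_eq_rpow p k hg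
  have hne := dEquiv_ppow_mul_purePacket_ne_zero p k
    ⌊(m : ℝ) / absRamificationIdx p (k i) - dSum p k - aSum p k⌋ (ne_zero_of_realizesNegB p k hh)
  have hA := packetAdm_iota_smul p k i hg0 (packetAdm_normalizedPacket p k)
  have hUC := hU.trans (autImages_smul_normalizedPacket_subset_translate p k h12 hI i m g hg h hh)
  refine ⟨packetAdm_packetHull p k hne hA hgU hUC, ?_⟩
  exact (packetLogμ_packetHull_le_smul_normalizedPacket p k hne hA hgU hUC).trans
    (Prop14iii₂_holds p k (DFac p k) (dEquiv p k) hI Istar htame i m h hh)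

/-! ## Step (vi): the unramified case -/

/-- **Step (vi) on the real packet**: under [IUTchIV] Prop. 1.2 (iv) (`Prop12iv`, hypothesis; `p > 2`, all
`e_i = 1`, `|I| ≥ 2`) the hull of the union of possible images of `(R_I)^∼` is `(R_I)^∼`, admissible with
`log μ̄ = 0` ("Such an upper bound “`0`”"). [cite: Mochizuki2012, IUTchIV Thm 1.10 proof Step (vi) p.29] -/
theorem packetLogμ_packetHull_autImages_normalizedPacket (h4 : Prop12iv p k) (hI : 2 ≤ Fintype.card I)
    (hp : 2 < p) (he : ∀ i, absRamificationIdx p (k i) = 1) :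
    PacketAdm p k (packetHull p k (autImages p k (normalizedPacket p k : Set (PacketAlgebra p k)))) ∧
      packetLogμ p k (packetHull p k (autImages p k (normalizedPacket p k : Set (PacketAlgebra p k)))) = 0 := by
  rw [packetHull_autImages_normalizedPacket p k h4 hI hp he]
  exact ⟨packetAdm_normalizedPacket p k, packetLogμ_normalizedPacket p k⟩

/-- Step (vi) for the hull of any region of possible images of `(R_I)^∼` containing `(R_I)^∼`: admissible,
`log μ̄ ≤ 0`. [cite: Mochizuki2012, IUTchIV Thm 1.10 proof Step (vi) p.29] -/
theorem packetLogμ_packetHull_nonpos_of_subset_autImages (h4 : Prop12iv p k) (hI : 2 ≤ Fintype.card I)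
    (hp : 2 < p) (he : ∀ i, absRamificationIdx p (k i) = 1) {U : Set (PacketAlgebra p k)}
    (hOU : (normalizedPacket p k : Set (PacketAlgebra p k)) ⊆ U)
    (hU : U ⊆ autImages p k (normalizedPacket p k : Set (PacketAlgebra p k))) :
    PacketAdm p k (packetHull p k U) ∧ packetLogμ p k (packetHull p k U) ≤ 0 := by
  have hsub : packetHull p k U ⊆ normalizedPacket p k :=
    packetHull_subset_normalizedPacket_of_subset_autImages p k h4 hI hp he hU
  have hadm : PacketAdm p k (packetHull p k U) :=
    packetAdm_of_subset_of_subset p k (packetAdm_normalizedPacket p k) (packetAdm_normalizedPacket p k)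
      (hOU.trans (subset_packetHull p k U)) hsub
  refine ⟨hadm, ?_⟩
  rw [← packetLogμ_normalizedPacket p k]
  exact packetLogμ_mono p k hadm (packetAdm_normalizedPacket p k) hsub

end Literature.IUT.LogVolume

end
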